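import Summits.BirchSwinnertonDyer.BirchSwinnertonDyer.Theorems.PrintCFramBottomClassIndexLawFiveLeFlipRungTwoThetaFactor
import Summits.BirchSwinnertonDyer.BirchSwinnertonDyer.Theorems.PrintCFramBottomClassIndexLawFiveLeFlipRungTwoThetaUnit
import Summits.BirchSwinnertonDyer.BirchSwinnertonDyer.Theorems.PrintCFramBottomClassIndexLawFiveLeHalfIntegralBridge
import HarnessLib

set_option autoImplicit false

/-!
# Crux `PrintCFram.BottomClassIndexLawFiveLe` (stmt-BirchSwinnertonDyer-20372), line `eisenstein-resource-bdp-line` (registry v29 `stub_flipRungs.2`,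
# the `8 ∣ m` half = LEAD's residual `stub_rungTwoEight` / w6 g10's (JMLTwoEight⁶)):
# THE 2-ADIC FLIPPED-CUSP RUNG FOR `e = 3`, piece P6e (first half) — `θ(16·)` AT THE FLIPPED CUSP `W₁₆ = γ₀·diag(256,1)` AND THE
# FACTORISATION `V ∣ γ₀ = Θ · B` FOR THE PRODUCT VEHICLE `V = P·θ(16·)`
# (cell `bsd-print-cfram`, width seat `bsd-line-cfram-p1-w8` g10; THEOREMS ONLY, `--supports` 20372 `--as helper`; BSD is not proved by any of this)

HONEST FRAMING. Pure bookkeeping about Shimura's `θ`, principal square roots and the weight-`(k+1)` slash; nothing here is a statement about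
BSD; no registered stub is closed. This is the `R = 16` twin of w5 g8's P4b (`…FlipRungTwoThetaFactor`): in the `e = 3` road (w8 g10) the Katz
vehicle is the PRODUCT `V = P·θ(16·)` (`P` = the class cut of `g = G|U_4` at modulus `16`; `θ(16·) = thetaMul 16`), read at `γ₀ = [a b; M 256] ∈ SL₂(ℤ)`
(`M` the odd level). THE KEY SIMPLIFICATION: `16·(γ₀•z) = δ•(z/16)` with **`δ = [16a b; M 16] ∈ SL₂(ℤ)`** (`det δ = 256a − bM = 1`), so `θ(16·)` at the
flipped cusp is `θ` at the ODD cusp `16a/M`, read by the tree's `shimuraTheta_smul_eq_tsum` at the point `z/16`, where `M·(z/16) + 16 = X/16`,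
`X = Mz + 256` (so `X/16 = 16(Mw+1)` at `z = 256w`, P6c's base):
* §1 `smul_flippedCusp_eq_delta_smul` (the point identity on `ℍ`), `thetaMul_sixteen_eq` (`thetaMul 16 τ = θ(16•τ)`), the branch constant
  `√(2iM/(X/16))·√(X/16) = √(2iM)` (no sign: `X/16 ∈ ℍ`);
* §2 **`thetaMul_sixteen_flippedCusp_mul_inv_csqrt`**: `θ(16·(γ₀•z))·(√(X/16))⁻¹ = (√(2iM))⁻¹ · Σ'_k exp(πi k² X/(32M))·G(16a,k;M)`, the termwise
  split `exp(πi k² X/(32M)) = e(z/64)^{k²}·e(8k²/M)` — `Θ` is a series in `e(z/64)` (at `z = 256w`: `e(4k²w)`, ¼-periodic like the junk of P6d)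
  with constant term `(√(2iM))⁻¹·G(16a;M)`, a unit of `ℤ̄[1/N]` (§3; `16a` is a unit mod `M`);
* §3 `(√(2iM))⁻¹` is a unit of `ℤ̄[1/N]` for `2M ∣ N` (`(√(2iM))⁴ = −4M²`);
* §4 **`slash_flippedCusp_eq_thetaSixteen_mul_bracket`**: for ANY `P` and `V = P·θ(16·)`:
  `(V ∣_{k+1} γ₀)(z) = Θ(z) · B(z)`, **`B(z) = 16^{−(k+1)}·(P(γ₀•z)·(√(X/16)^{2k+1})⁻¹)`**, and `level_smul_add_div_sixteen`: `X/16 = 16(Mw+1)` at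
  `z = 256•w`.

No definitions, no named facts, no `sorry`. beyond-print theorem: NO. References: [Shimura1973HalfIntegral] §1 (θ under `SL₂(ℤ)`);
[KoblitzECMF1993] III §3, IV §1; crux notes w7g8-T6 §5b–§5d; w8 g10 STATUS 11:14:53Z.
-/

-- summit-side namespace `Summit.BirchSwinnertonDyer.BirchSwinnertonDyer.…` (single-conjunct summit, D-0017 layout)
set_option linter.dupNamespace false

noncomputable section

open scoped MatrixGroups ModularForm Real Classical
open UpperHalfPlane hiding I
open Complex CongruenceSubgroup Function
open Literature.NumberTheory.EllipticCurves.ModularForms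
open Literature.NumberTheory.EllipticCurves.Tunnell1983 (thetaMul thetaMul_eq_shimuraTheta)

namespace Summit.BirchSwinnertonDyer.BirchSwinnertonDyer.Theorems.PrintCFram.FlipRung

/-! ## §1 The point identity `16·(γ₀•z) = δ•(z/16)` and the branch constant -/

/-- `Mz + 256 ∈ ℍ` for `M > 0`, `z ∈ ℍ`. [folklore] -/
theorem im_level_mul_add_256_pos {M : ℕ} (hM : 0 < M) (z : ℍ) : 0 < ((M : ℂ) * z + 256).im := by
  have : ((M : ℂ) * z + 256).im = (M : ℝ) * z.im := by simp
  rw [this]; exact mul_pos (by exact_mod_cast hM) z.im_pos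

/-- **`16·(γ₀•z) = δ•(z/16)`** for `γ₀ = [a b; M 256]` and `δ = [16a b; M 16]` (both of determinant `256a − bM = 1`), as points of `ℍ`.
[folklore] -/
theorem smul_flippedCusp_eq_delta_smul (γ₀ δ : SL(2, ℤ)) {M a b : ℤ}
    (h00 : (γ₀ 0 0 : ℤ) = a) (h01 : (γ₀ 0 1 : ℤ) = b) (h10 : (γ₀ 1 0 : ℤ) = M) (h11 : (γ₀ 1 1 : ℤ) = 256)
    (d00 : (δ 0 0 : ℤ) = 16 * a) (d01 : (δ 0 1 : ℤ) = b) (d10 : (δ 1 0 : ℤ) = M) (d11 : (δ 1 1 : ℤ) = 16) (z : ℍ) :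
    ((⟨16, by norm_num⟩ : {x : ℝ // 0 < x}) • (γ₀ • z) : ℍ) = δ • ((⟨1 / 16, by norm_num⟩ : {x : ℝ // 0 < x}) • z) := by
  have hden : (M : ℂ) * (z : ℂ) + 256 ≠ 0 := by
    have h := denom_ne_zero γ₀ z
    rw [ModularGroup.denom_apply, h10, h11] at h
    simpa using h
  have hden' : (M : ℂ) * ((1 / 16 : ℂ) * (z : ℂ)) + 16 ≠ 0 := by
    intro h
    apply hden
    linear_combination 16 * h
  apply UpperHalfPlane.ext
  rw [coe_pos_real_smul, coe_specialLinearGroup_apply, coe_specialLinearGroup_apply, coe_pos_real_smul, h00, h01, h10, h11,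
    d00, d01, d10, d11]
  simp only [eq_intCast, Complex.real_smul, Complex.ofReal_div, Complex.ofReal_one, Complex.ofReal_ofNat]
  push_cast
  field_simp
  ring

/-- `thetaMul 16 τ = θ(16•τ)` (Tunnell's `θ_{16}` is Shimura's `θ` at the dilated point). [folklore] -/
theorem thetaMul_sixteen_eq (τ : ℍ) : thetaMul 16 τ = shimuraTheta ((⟨16, by norm_num⟩ : {x : ℝ // 0 < x}) • τ) := by
  rw [thetaMul_eq_shimuraTheta (by norm_num : 0 < 16)]
  congr 1

/-- **THE BRANCH CONSTANT (modulus `16`).** For `M > 0` and `X` in the upper half-plane, `√(2iM/(X/16))·√(X/16) = √(2iM)` (principal square roots;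
the tree's `csqrt_div_mul_csqrt`: no sign because `X/16 ∈ ℍ`, `Im(2iM) > 0`). [folklore] -/
theorem csqrt_twoIM_div_mul_csqrt_div_sixteen {M : ℕ} (hM : 0 < M) {X : ℂ} (hX : 0 < X.im) :
    Complex.sqrt (2 * I * M / (X / 16)) * Complex.sqrt (X / 16) = Complex.sqrt (2 * I * M) := by
  have hu : 0 < (X / 16).im := by
    rw [show X / 16 = X / ((16 : ℝ) : ℂ) by norm_num, Complex.div_ofReal_im]; positivity
  have hMR : (0 : ℝ) < M := by exact_mod_cast hM
  have hYi' : (2 * I * M : ℂ).im = 2 * (M : ℝ) := by simp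
  have hY : (2 * I * M : ℂ) ≠ 0 := by
    intro h; have := congrArg Complex.im h; rw [hYi'] at this; simp at this; linarith
  have hYi : 0 ≤ (2 * I * M : ℂ).im := by rw [hYi']; positivity
  exact csqrt_div_mul_csqrt hu hY hYi

/-! ## §2 `θ(16·)` at the flipped cusp -/

/-- **THE θ(16·)-FACTOR.** For `γ₀ = [a b; M 256] ∈ SL₂(ℤ)` with `M > 0` and `z ∈ ℍ`, `X = Mz + 256`:
`θ(16·(γ₀•z))·(√(X/16))⁻¹ = (√(2iM))⁻¹ · Σ'_{k ∈ ℤ} exp(πi k² (X/16)/(2M))·G(16a,k;M)` — the tree's transformation law `shimuraTheta_smul_eq_tsum`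
at `δ = [16a b; M 16]` and the point `z/16` (`M(z/16) + 16 = X/16`), with the prefactor merged into P6c's base by §1.
[cite: Shimura1973HalfIntegral, §1] [cite: KoblitzECMF1993, IV §1] -/
theorem thetaMul_sixteen_flippedCusp_mul_inv_csqrt (γ₀ : SL(2, ℤ)) {M : ℕ} [NeZero M] {a b : ℤ}
    (h00 : (γ₀ 0 0 : ℤ) = a) (h01 : (γ₀ 0 1 : ℤ) = b) (hM : (γ₀ 1 0 : ℤ) = M) (h256 : (γ₀ 1 1 : ℤ) = 256) (z : ℍ) :
    thetaMul 16 (γ₀ • z) * (Complex.sqrt (((M : ℂ) * z + 256) / 16))⁻¹ =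
      (Complex.sqrt (2 * I * M))⁻¹ *
        ∑' k : ℤ, cexp (Real.pi * I * k ^ 2 * ((((M : ℂ) * z + 256) / 16) / (2 * M))) * quadGaussSum M ((16 * a : ℤ) : ZMod M) k := by
  have hMpos : 0 < M := Nat.pos_of_ne_zero (NeZero.ne M)
  have hX := im_level_mul_add_256_pos hMpos z
  -- the determinant `256a − bM = 1` and the matrix `δ = [16a b; M 16]`
  have hdet : a * 256 - b * (M : ℤ) = 1 := by
    have := Matrix.det_fin_two (γ₀ : Matrix (Fin 2) (Fin 2) ℤ)
    rw [Matrix.SpecialLinearGroup.det_coe, h00, h01, hM, h256] at this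
    linear_combination -this
  let δ : SL(2, ℤ) := ⟨!![16 * a, b; (M : ℤ), 16], by rw [Matrix.det_fin_two_of]; linear_combination hdet⟩
  have d00 : (δ 0 0 : ℤ) = 16 * a := rfl
  have d01 : (δ 0 1 : ℤ) = b := rfl
  have d10 : (δ 1 0 : ℤ) = M := rfl
  have d11 : (δ 1 1 : ℤ) = 16 := rfl
  have hpt := smul_flippedCusp_eq_delta_smul γ₀ δ h00 h01 hM h256 d00 d01 d10 d11 z
  have hkey := csqrt_twoIM_div_mul_csqrt_div_sixteen hMpos hX
  rw [thetaMul_sixteen_eq, hpt, shimuraTheta_smul_eq_tsum (γ := δ) (c := M) d10, d11, d00]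
  have hu : (M : ℂ) * ((((⟨1 / 16, by norm_num⟩ : {x : ℝ // 0 < x}) • z : ℍ)) : ℂ) + ((16 : ℤ) : ℂ) =
      ((M : ℂ) * z + 256) / 16 := by
    rw [coe_pos_real_smul, Complex.real_smul]
    push_cast
    ring
  rw [hu, cpow_one_half_eq_csqrt, ← hkey, mul_inv, one_div]
  ring

/-- The termwise split `exp(πi k² (X/16)/(2M)) = exp(πi k² z/32)·exp(8πi k²/M)` for `X = Mz + 256` (`X/(32M) = z/32 + 8/M`). [folklore] -/
theorem cexp_thetaSixteenTerm_split {M : ℕ} (hM : 0 < M) (k : ℤ) (z : ℂ) :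
    cexp (Real.pi * I * k ^ 2 * ((((M : ℂ) * z + 256) / 16) / (2 * M))) =
      cexp (Real.pi * I * k ^ 2 * (z / 32)) * cexp (8 * Real.pi * I * k ^ 2 / M) := by
  rw [← Complex.exp_add]
  congr 1
  have hM' : (M : ℂ) ≠ 0 := by exact_mod_cast hM.ne'
  field_simp
  ring

/-- `exp(πi k² z/32) = e(z/64)^{k²}`: the `θ(16·)`-factor is a series in the parameter `𝕢₆₄(z) = e(z/64)` (frequencies `k²`; at `z = 256w` these are
`e(4k²w)`). [folklore] -/
theorem cexp_pi_I_sq_mul_div_thirtytwo_eq_qParam_pow (k : ℤ) (z : ℂ) :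
    cexp (Real.pi * I * k ^ 2 * (z / 32)) = Periodic.qParam 64 z ^ (k.natAbs ^ 2) := by
  have hk : ((k.natAbs : ℕ) : ℂ) ^ 2 = (k : ℂ) ^ 2 := by
    have h : ((k.natAbs : ℤ) : ℂ) ^ 2 = ((k ^ 2 : ℤ) : ℂ) := by
      rw [← Int.cast_pow, Int.natAbs_sq]
    rw [Int.cast_natCast, Int.cast_pow] at h
    exact h
  rw [Periodic.qParam, ← Complex.exp_nat_mul]
  congr 1
  push_cast
  rw [hk]
  ring

/-! ## §3 The constant `(√(2iM))⁻¹` is a unit of `ℤ̄[1/N]` for `2M ∣ N` -/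

/-- `(√(2iM))⁴ = −4M²`, so `√(2iM)` is an algebraic integer. [folklore] -/
theorem isIntegral_csqrt_twoIM (M : ℕ) : IsIntegral ℤ (Complex.sqrt (2 * I * M)) := by
  have h2 : (Complex.sqrt (2 * I * M)) ^ 2 = 2 * I * M := csqrt_sq _
  have h4 : (Complex.sqrt (2 * I * M)) ^ 4 = ((-(4 * (M : ℤ) ^ 2) : ℤ) : ℂ) := by
    rw [show (4 : ℕ) = 2 * 2 from rfl, pow_mul, h2, mul_pow, mul_pow, I_sq]; push_cast; ring
  refine IsIntegral.of_pow (by norm_num : 0 < 4) ?_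
  rw [h4]
  exact isIntegral_intCast _

/-- **`(√(2iM))⁻¹` is a unit of `ℤ̄[1/N]`** for `2M ∣ N`, `M ≠ 0`: it lies in `ℤ̄[1/N]` (it equals `√(2iM)·(−i)·(2M)⁻¹`) and its inverse `√(2iM)`
is an algebraic integer. [folklore] -/
theorem csqrt_twoIM_inv_mem {N M : ℕ} (h2MN : 2 * M ∣ N) (hM : M ≠ 0) :
    (∃ j : ℕ, IsIntegral ℤ ((N : ℂ) ^ j * (Complex.sqrt (2 * I * M))⁻¹)) ∧
    ∃ v : ℂ, (∃ j : ℕ, IsIntegral ℤ ((N : ℂ) ^ j * v)) ∧ (Complex.sqrt (2 * I * M))⁻¹ * v = 1 := by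
  have hMC : (M : ℂ) ≠ 0 := by exact_mod_cast hM
  have hs2 : Complex.sqrt (2 * I * M) ^ 2 = 2 * I * M := csqrt_sq _
  have hne : (2 * I * M : ℂ) ≠ 0 := by simp [hMC, I_ne_zero]
  have hs0 : Complex.sqrt (2 * I * M) ≠ 0 := by
    intro h0; rw [h0, zero_pow two_ne_zero] at hs2; exact hne hs2.symm
  refine ⟨?_, Complex.sqrt (2 * I * M), ⟨0, by simpa using isIntegral_csqrt_twoIM M⟩, inv_mul_cancel₀ hs0⟩
  -- `(√(2iM))⁻¹ = √(2iM) · ((−i) · (2M)⁻¹)`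
  have hinv : (Complex.sqrt (2 * I * M))⁻¹ = Complex.sqrt (2 * I * M) * ((-I) * (((2 * M : ℕ)) : ℂ)⁻¹) := by
    have h1 : Complex.sqrt (2 * I * M) * (Complex.sqrt (2 * I * M) * ((-I) * (((2 * M : ℕ)) : ℂ)⁻¹)) = 1 := by
      rw [← mul_assoc, ← sq, hs2]
      push_cast
      field_simp
      rw [I_sq]
      ring
    exact (eq_inv_of_mul_eq_one_right h1).symm
  rw [hinv]
  refine exists_isIntegral_pow_mul_mul ⟨0, by simpa using isIntegral_csqrt_twoIM M⟩
    (exists_isIntegral_pow_mul_mul ?_ (exists_isIntegral_pow_mul_inv_of_dvd (by omega) h2MN))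
  have hI : IsIntegral ℤ (-I : ℂ) := isIntegral_I.neg
  exact exists_isIntegral_pow_mul_of_isIntegral hI

/-- **The constant term `(√(2iM))⁻¹·G(16a;M)` is a unit of `ℤ̄[1/N]`** for `M` odd, `2M ∣ N`, `256a − bM = 1` (`16a·16 ≡ 1 (mod M)`).
[cite: IwaniecKowalski2004, §3.4] -/
theorem thetaSixteen_constant_unit {M N : ℕ} [NeZero M] (hModd : Odd M) (h2MN : 2 * M ∣ N) {a b : ℤ}
    (hdet : 256 * a - (M : ℤ) * b = 1) :
    ∃ v : ℂ, (∃ j : ℕ, IsIntegral ℤ ((N : ℂ) ^ j * v)) ∧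
      ((Complex.sqrt (2 * I * M))⁻¹ * quadGaussSum M ((16 * a : ℤ) : ZMod M) 0) * v = 1 := by
  have hMN : M ∣ N := dvd_trans (dvd_mul_left M 2) h2MN
  have ha : IsUnit (((16 * a : ℤ)) : ZMod M) := by
    have h : (((16 * a : ℤ)) : ZMod M) * ((16 : ℤ) : ZMod M) = 1 := by
      have := congrArg (fun z : ℤ ↦ (z : ZMod M)) hdet
      simp only [Int.cast_sub, Int.cast_mul, Int.cast_one, Int.cast_natCast, ZMod.natCast_self, zero_mul, sub_zero,
        Int.cast_ofNat] at this
      push_cast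
      linear_combination this
    exact IsUnit.of_mul_eq_one _ h
  obtain ⟨vG, hvG, hG⟩ := exists_inverse_quadGaussSum (N := N) hModd hMN ha
  obtain ⟨vc, hvc, hc⟩ := (csqrt_twoIM_inv_mem (N := N) h2MN (NeZero.ne M)).2
  refine ⟨vc * vG, exists_isIntegral_pow_mul_mul hvc hvG, ?_⟩
  calc (Complex.sqrt (2 * I * M))⁻¹ * quadGaussSum M ((16 * a : ℤ) : ZMod M) 0 * (vc * vG)
      = ((Complex.sqrt (2 * I * M))⁻¹ * vc) * (quadGaussSum M ((16 * a : ℤ) : ZMod M) 0 * vG) := by ring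
    _ = 1 := by rw [hc, hG, one_mul]

/-! ## §4 The factorisation `V ∣ γ₀ = Θ · B` for the product vehicle `V = P·θ(16·)` -/

/-- **THE FACTORISATION AT THE FLIPPED CUSP (product vehicle).** For `γ₀ = [a b; M 256] ∈ SL₂(ℤ)` (`M > 0`), ANY `P : ℍ → ℂ` and
`V = P·θ(16·)` (`V z = P z * thetaMul 16 z`), every `k` and `z ∈ ℍ`, with `X = Mz + 256` and `s = √(X/16)`:
`(V ∣_{k+1} γ₀)(z) = [θ(16·(γ₀•z))·s⁻¹] · [16^{−(k+1)}·(P(γ₀•z)·(s^{2k+1})⁻¹)]` — `Θ · B` with `Θ` the θ(16·)-factor of §2 and `B` the bracket in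
P6c's normalisation (`s = √(16(Mw+1))` at `z = 256w`). Only `(s²)^{k+1} = (X/16)^{k+1}` is used: no branch enters `B`. [cite: Shimura1973HalfIntegral, §1] -/
theorem slash_flippedCusp_eq_thetaSixteen_mul_bracket (γ₀ : SL(2, ℤ)) {M : ℕ} [NeZero M] (hM : (γ₀ 1 0 : ℤ) = M)
    (h256 : (γ₀ 1 1 : ℤ) = 256) (k : ℕ) {P V : ℍ → ℂ} (hV : ∀ z : ℍ, V z = P z * thetaMul 16 z) (z : ℍ) :
    (V ∣[((k + 1 : ℕ) : ℤ)] γ₀) z =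
      (thetaMul 16 (γ₀ • z) * (Complex.sqrt (((M : ℂ) * z + 256) / 16))⁻¹) *
        (((16 : ℂ)⁻¹) ^ (k + 1) * (P (γ₀ • z) * (Complex.sqrt (((M : ℂ) * z + 256) / 16) ^ (2 * k + 1))⁻¹)) := by
  have hMpos : 0 < M := Nat.pos_of_ne_zero (NeZero.ne M)
  have hX := im_level_mul_add_256_pos hMpos z
  have hX0 : (M : ℂ) * z + 256 ≠ 0 := by intro h; rw [h] at hX; simp at hX
  set s : ℂ := Complex.sqrt (((M : ℂ) * z + 256) / 16) with hsdef
  have hs2 : s ^ 2 = ((M : ℂ) * z + 256) / 16 := csqrt_sq _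
  have hs0 : s ≠ 0 := by
    intro h0; rw [h0] at hs2
    have : (M : ℂ) * z + 256 = 0 := by
      have := hs2; field_simp at this; linear_combination -this
    exact hX0 this
  have hXs : (M : ℂ) * z + 256 = 16 * s ^ 2 := by rw [hs2]; field_simp
  rw [ModularForm.SL_slash_apply, hV, ModularGroup.denom_apply, hM, h256]
  simp only [Int.cast_natCast, Int.cast_ofNat]
  rw [hXs, zpow_neg, zpow_natCast, inv_pow]
  field_simp
  ring

/-- At `z = 256•w` the common base is P6c's: `(M·(256•w) + 256)/16 = 16(Mw + 1)`. [folklore] -/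
theorem level_smul_add_div_sixteen {M : ℕ} (c : {x : ℝ // 0 < x}) (hc : (c : ℝ) = 256) (w : ℍ) :
    ((M : ℂ) * (((c • w : ℍ)) : ℂ) + 256) / 16 = 16 * ((M : ℂ) * w + 1) := by
  rw [coe_pos_real_smul, hc, Complex.real_smul]
  push_cast
  ring

end Summit.BirchSwinnertonDyer.BirchSwinnertonDyer.Theorems.PrintCFram.FlipRung

end
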